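import Summits.CriticalPhenomena.CardyFormulaZ2.Theorems.CardyWhiteToColouredSimilarityUpgradeOfRectilinearHeart
import Summits.CriticalPhenomena.CardyFormulaZ2.Theorems.CardyWickAnisotropyBoxFamilyToCardyStubDomainContinuity

/-!
# One-map sketch for crux `SimilarityUpgrade` (stmt-CriticalPhenomena-4597): similarity + ONE
# non-Möbius symmetry (`z ↦ z²`) + loop continuity ⇒ conformal invariance

Lead c6 (prover-line-stmt-CriticalPhenomena-4597-c6-0, 2026-08-17). Typed record of the reduction
described in `LEAD-REPORT-c6.md` §NEW and in the crux idea card `Ideas/one-map-upgrade.md`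
(no `sorry`; the three inputs are NAMED PROPOSITIONS taken as hypotheses, not registered stubs —
this is NOT a registered skeleton of a line; the registered line stays `registered`/`Lines/birth.lean`).

* `OneMapUpgrade` (U, model-free complex analysis): a functional `Φ` on conformal rectangles that is
  loop-continuous (`LoopContinuous`), invariant under complex affine maps in the crux's sense
  (`AffineInvariant`, verbatim hypothesis (ii) of the crux) and invariant under the squaring map on
  quads compactly inside the upper half-plane (`SqInvariant`) is a function of the conformal modulus
  (`ModulusDetermines`). Proof route (not formalised here; advisor-reviewed, c6): chirality first —
  (ii) with `a = 1, w = 0` identifies a quad with its reversed relabelling `(p1, p0, p3, p2)` (same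
  carrier, same arcs 0/2 as sets, same modulus, opposite chirality), so WLOG equal chirality and a
  mark-matching conformal map exists; then: affine maps and `z²` generate, exactly,
  every elementary Loewner slit map `x + √((z-x)² + 4s) = T_x ∘ S⁻¹ ∘ T_{4s} ∘ S ∘ T_{-x}` on
  `ℍ ∖ [x, x + 2i√s]`; the Euler scheme `((2/h)(√(1 + h·) - 1))^{∘n}`, `h = 4t/n` real (each step a
  word affine ∘ √ ∘ affine, `= id - (h/4) z² + O(h²)`, Lipschitz `1 + O(h)` on compacts), converges on
  compacts of `ℍ` to the Möbius flow `z ↦ z/(1 + t z)` of the field `-z²∂`, so the closure (uniform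
  convergence on compacts, univalent
  limits) of the generated pseudogroup contains PSL₂(ℝ) (real `t`: translations and the transvections
  `z ↦ z/(1+tz)` generate it; branch cuts are never approached for real `h`); words in
  slit maps are the Loewner maps of STEP drivers, which converge to `g_U` for continuous `U` by the
  tree's two-driver tube estimate / KS Lemma 5.4 (`LoewnerDriverStability`,
  `LoewnerDriverUniformStability`, cocycle `LoewnerHullCocycle`), and arc hulls have continuous
  drivers (`IsArcHull.exists_loewner_chain_holds`), so every arc-hull uniformizer `g_K` is a limit
  of words; an inversion `z ↦ -1/(z - x₀)` turns a polygonal quad resting on `ℝ` along one edge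
  into `ℍ ∖ K` for an arc hull `K`; hence every conformal map between such quads is, on compacts,
  a limit of words in {affine, `S`, `S⁻¹`}; loop continuity + interior exhaustion by square models
  (`exists_isSquareModel`) + Carathéodory boundary extension + the rectilinear closure pattern of
  c1 (`exists_rectilinear_close`, `tendsto_crossRatio_of_tendstoUniformly`) finish.
* `FullLimitLoopContinuity` (C, percolation): a full limit of the bond-ℤ² crossing probabilities is
  loop-continuous — PROVED BELOW (`fullLimitLoopContinuity_holds`) in ten lines from the tree theorem
  `BoxFamilyToCardy.Birth.stub_domainContinuity` (S2 of stmt-0794/14215, p158922: mesh-uniform loop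
  continuity of `bondDomainCrossingProb`, Schramm–Smirnov Lemma 5.1 technology) by passing to the limit.
* `FullLimitSqInvariance` (Z, OPEN — the new heart): a full, similarity-invariant limit is invariant
  under `z ↦ z²` on quads compactly inside `ℍ`. Necessary (it is an instance of conformal
  invariance, implied by X_U); no mechanism is claimed; the cell-swapping count of LEAD-REPORT-c5
  applies to it verbatim.

Compositions (sorry-free): `modulusDetermines_of_oneMap`, `rectilinearHeart_of_oneMap` (U, C, Z ⇒ the
registered heart H3 verbatim), `similarityUpgrade_of_oneMap` (⇒ the crux, by name, through the
landed `similarityUpgrade_of_rectilinearHeart`), and with C discharged: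
`similarityUpgrade_of_oneMapUpgrade_of_sqInvariance : OneMapUpgrade → FullLimitSqInvariance → crux`
— the crux follows from ONE provable model-free theorem (U) and ONE open identity (Z).
-/

noncomputable section

namespace Summit.CriticalPhenomena.CardyFormulaZ2.Cruxes.SimilarityUpgrade.OneMap

open Filter Topology Set
open Literature.Probability.RandomPlanarGeometry
open Literature.Probability.Percolation (bondDomainCrossingProb)

/-- Full limits (first clause of the crux hypothesis). [folklore] -/
def FullLimit (Φ : ConformalRectangle → ℝ) : Prop :=
  ∀ R : ConformalRectangle, Tendsto (bondDomainCrossingProb R) (𝓝[>] (0 : ℝ)) (𝓝 (Φ R))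

/-- Invariance under complex affine maps, verbatim hypothesis (ii) of the crux (with `a = 1, w = 0`
it also says that `Φ R` depends only on the carrier and the arcs `0`, `2`). [folklore] -/
def AffineInvariant (Φ : ConformalRectangle → ℝ) : Prop :=
  ∀ (R R' : ConformalRectangle) (a w : ℂ), a ≠ 0 →
    R'.carrier = (fun z : ℂ => a * z + w) '' R.carrier →
    R'.arc 0 = (fun z : ℂ => a * z + w) '' R.arc 0 →
    R'.arc 2 = (fun z : ℂ => a * z + w) '' R.arc 2 → Φ R' = Φ R

/-- **Invariance under the ONE extra map `S : z ↦ z²`**, on quads whose closed carrier lies in the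
open upper half-plane (where `S` is injective): if the carrier and the arcs `0`, `2` of `R'` are the
`S`-images of those of `R`, then `Φ R' = Φ R`. [folklore] -/
def SqInvariant (Φ : ConformalRectangle → ℝ) : Prop :=
  ∀ R R' : ConformalRectangle, closure R.carrier ⊆ {z : ℂ | 0 < z.im} →
    R'.carrier = (fun z : ℂ => z ^ 2) '' R.carrier →
    R'.arc 0 = (fun z : ℂ => z ^ 2) '' R.arc 0 →
    R'.arc 2 = (fun z : ℂ => z ^ 2) '' R.arc 2 → Φ R' = Φ R

/-- **Loop continuity** (Schramm–Smirnov uniform metric on marked loops): `Φ R'` is close to `Φ R`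
as soon as the boundary parametrisation of `R'` is uniformly close to that of `R` and the mark
parameters are close. [cite: SchrammSmirnov2011, §5 eq. (5.1) (arXiv §6 Lemma 6.1)] -/
def LoopContinuous (Φ : ConformalRectangle → ℝ) : Prop :=
  ∀ R : ConformalRectangle, ∀ ε : ℝ, 0 < ε → ∃ η : ℝ, 0 < η ∧ ∀ R' : ConformalRectangle,
    (∀ t : ℝ, dist (R'.boundary t) (R.boundary t) ≤ η) →
    (∀ i : Fin 4, |R'.mark i - R.mark i| ≤ η) → |Φ R' - Φ R| ≤ ε

/-- `Φ` is a function of the conformal modulus: quads with uniformizing data of equal cross-ratio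
have the same value. [folklore] -/
def ModulusDetermines (Φ : ConformalRectangle → ℝ) : Prop :=
  ∀ (R R' : ConformalRectangle)
    (φ : ConformalEquiv UpperHalfPlane.upperHalfPlaneSet R.carrier) (x : Fin 4 → ℝ)
    (φ' : ConformalEquiv UpperHalfPlane.upperHalfPlaneSet R'.carrier) (x' : Fin 4 → ℝ),
    R.IsUniformizing φ x → R'.IsUniformizing φ' x' → crossRatio x = crossRatio x' → Φ R = Φ R'

/-- **U — the one-map upgrade (model-free).** Loop continuity + affine invariance + invariance
under `z ↦ z²` on quads in `ℍ` ⇒ `Φ` is a function of the conformal modulus. True (Loewner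
slit maps are words in affine maps and `z²`; [LSW] Lemma 3.5 density, in the tree; Möbius maps by
an Euler scheme; inversion trick; square-model exhaustion); provable, size L. [folklore] -/
def OneMapUpgrade : Prop :=
  ∀ Φ : ConformalRectangle → ℝ, LoopContinuous Φ → AffineInvariant Φ → SqInvariant Φ →
    ModulusDetermines Φ

/-- **C — full limits are loop-continuous** (Schramm–Smirnov 2011 §5; provable from the tree's
discrete continuity machinery, size M). [cite: SchrammSmirnov2011, §5 eq. (5.1) (arXiv §6 Lemma 6.1)] -/
def FullLimitLoopContinuity : Prop :=
  ∀ Φ : ConformalRectangle → ℝ, FullLimit Φ → LoopContinuous Φ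

/-- **Z — the new heart (OPEN)**: a full, similarity-invariant limit of the bond-ℤ² crossing
probabilities is invariant under the squaring map on quads compactly inside `ℍ`. An instance of
conformal invariance (necessary); no mechanism known. [cite: Schramm2007ICM, §2.6 Problem 2.11] -/
def FullLimitSqInvariance : Prop :=
  ∀ Φ : ConformalRectangle → ℝ, FullLimit Φ → AffineInvariant Φ → SqInvariant Φ

/-- **U + C + Z ⇒ the modulus determines every full similarity-invariant limit.** -/
theorem modulusDetermines_of_oneMap (hU : OneMapUpgrade) (hC : FullLimitLoopContinuity)
    (hZ : FullLimitSqInvariance) :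
    ∀ Φ : ConformalRectangle → ℝ, FullLimit Φ → AffineInvariant Φ → ModulusDetermines Φ :=
  fun Φ hF hA => hU Φ (hC Φ hF) hA (hZ Φ hF hA)

/-- **U + C + Z ⇒ H3**, the registered heart `stub_rectilinearHeart` of line `registered`, verbatim
(the rectilinearity of `R` and the corner-box shape of `R'` are not even used). -/
theorem rectilinearHeart_of_oneMap (hU : OneMapUpgrade) (hC : FullLimitLoopContinuity)
    (hZ : FullLimitSqInvariance) :
    ∀ Φ : ConformalRectangle → ℝ,
      (∀ R : ConformalRectangle, Tendsto (bondDomainCrossingProb R) (𝓝[>] (0 : ℝ)) (𝓝 (Φ R))) →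
      (∀ (R R' : ConformalRectangle) (a w : ℂ), a ≠ 0 →
        R'.carrier = (fun z : ℂ => a * z + w) '' R.carrier →
        R'.arc 0 = (fun z : ℂ => a * z + w) '' R.arc 0 →
        R'.arc 2 = (fun z : ℂ => a * z + w) '' R.arc 2 → Φ R' = Φ R) →
      ∀ (R R' : ConformalRectangle),
        (∃ S : Finset (ℂ × ℂ), (∀ p ∈ S, p.1.re = p.2.re ∨ p.1.im = p.2.im) ∧
          frontier R.carrier ⊆ ⋃ p ∈ S, segment ℝ p.1 p.2) →
        (∃ w : ℝ, 0 < w ∧ R'.carrier = (Ioo (0 : ℝ) w ×ℂ Ioo (0 : ℝ) 1) ∧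
          R'.arc 0 = {z : ℂ | z.re = 0 ∧ z.im ∈ Icc (0 : ℝ) 1} ∧
          R'.arc 2 = {z : ℂ | z.re = w ∧ z.im ∈ Icc (0 : ℝ) 1} ∧
          R'.pt 0 = Complex.I ∧ R'.pt 1 = 0 ∧ R'.pt 2 = (w : ℂ) ∧ R'.pt 3 = (w : ℂ) + Complex.I) →
        ∀ (φ : ConformalEquiv UpperHalfPlane.upperHalfPlaneSet R.carrier) (x : Fin 4 → ℝ)
          (φ' : ConformalEquiv UpperHalfPlane.upperHalfPlaneSet R'.carrier) (x' : Fin 4 → ℝ),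
          R.IsUniformizing φ x → R'.IsUniformizing φ' x' → crossRatio x = crossRatio x' →
          Φ R = Φ R' :=
  fun Φ hF hA R R' _ _ φ x φ' x' hx hx' hη =>
    modulusDetermines_of_oneMap hU hC hZ Φ hF hA R R' φ x φ' x' hx hx' hη

/-- **U + C + Z ⇒ the crux `SimilarityUpgrade`**, by name (through the landed
`similarityUpgrade_of_rectilinearHeart`). -/
theorem similarityUpgrade_of_oneMap (hU : OneMapUpgrade) (hC : FullLimitLoopContinuity)
    (hZ : FullLimitSqInvariance) :
    Summit.CriticalPhenomena.CardyFormulaZ2.Theses.CardyWhiteToColoured.SimilarityUpgrade :=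
  Theorems.SimilarityUpgradeReduction.similarityUpgrade_of_rectilinearHeart
    (rectilinearHeart_of_oneMap hU hC hZ)

/-- **C holds**: a full limit of the bond-ℤ² crossing probabilities is loop-continuous — from the tree
theorem `stub_domainContinuity` (S2 of stmt-0794, shared with stmt-14215; mesh-uniform loop continuity
of `bondDomainCrossingProb`) by passing to the limit along the non-trivial filter `𝓝[>] 0`. -/
theorem fullLimitLoopContinuity_holds : FullLimitLoopContinuity := by
  intro Φ hF R ε hε
  obtain ⟨η, hη, h⟩ := BoxFamilyToCardy.Birth.stub_domainContinuity R ε hε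
  refine ⟨η, hη, fun R' hb hm => ?_⟩
  have hlim : Tendsto (fun δ : ℝ => |bondDomainCrossingProb R' δ - bondDomainCrossingProb R δ|)
      (𝓝[>] (0 : ℝ)) (𝓝 |Φ R' - Φ R|) :=
    ((hF R').sub (hF R)).abs
  exact le_of_tendsto hlim (h R' hb hm)

/-- **The crux from ONE provable theorem and ONE open identity**: `OneMapUpgrade` (model-free,
provable) and `FullLimitSqInvariance` (the `z²`-identity, open) imply `SimilarityUpgrade`, the loop
continuity C being discharged by `fullLimitLoopContinuity_holds`. -/
theorem similarityUpgrade_of_oneMapUpgrade_of_sqInvariance (hU : OneMapUpgrade)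
    (hZ : FullLimitSqInvariance) :
    Summit.CriticalPhenomena.CardyFormulaZ2.Theses.CardyWhiteToColoured.SimilarityUpgrade :=
  similarityUpgrade_of_oneMap hU fullLimitLoopContinuity_holds hZ

end Summit.CriticalPhenomena.CardyFormulaZ2.Cruxes.SimilarityUpgrade.OneMap

end
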